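import Literature.AlgebraicGeometry.HodgeTheory.WeilClassesBFSheafSeed
import Literature.AlgebraicGeometry.HodgeTheory.WeilClassesAnchorEngine
import HarnessLib

/-!
# Weil classes: Buchweitz–Flenner sheaf seeds AT ONE ANCHOR (pointwise door II′) and class-level designs

Infrastructure for the anchor routes on the Weil-type ladder (`KleimanBFSeeds`, `TensorMonadSeeds`,
`DoublyPolarisedTransport`): the tree's sheaf door `hasLocallyAlgebraicTensorAnchors_of_BF_of_tensorBFSheafSeeds`
(`WeilClassesBFSheafSeed`) is stated for the tensor-product anchor family, but its proof never uses the tensor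
structure. This file isolates the POINTWISE form: at one polarised Weil-type anchor `(P, h, w)` (`w` a class of
degree `2n`), an `I`-semiregular finite locally free sheaf `E₀` on every model `X₀ ≅ P` whose Chern character
(read through a `ChernCharacterBetti` `C`) satisfies `chₙ(E₀) = q·hⁿ + N·w` (`N ≠ 0`) and `chₚ(E₀) = cₚ·hᵖ`
(`p ∈ I ∖ {n}`) — a **BF sheaf seed at the anchor**, `HasBFSheafSeedAt C n P h w` — gives the local clause
`WeilAnchorLocalClause n d P h w` of the anchor engine, by Buchweitz–Flenner's variational Hodge theorem for
`I`-semiregular sheaves [cite: BuchweitzFlenner2003, §5 Thm. 5.1] (named fact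
`BuchweitzFlenner2003_variationalHodge_ISemiregular`, taken as a hypothesis): in a family of the clause through
`P ≅ 𝒳_{s₀}` with global classes `H`, `W` restricting to `h`, `w`, put `B := q·Hⁿ + N·W`; restrictions of
global classes are flat and fibrewise of Hodge type `(p,p)`, so BF gives an open `W' ∋ s₀` on whose path component
`B|_t` is algebraic; subtract `q·H|_tⁿ` and divide by `N`.

The companion predicate `HasWeilClassDesignAt C n P h w` is the CLASS-LEVEL stage ("design"): on every model a
finite locally free `E₀` with `chₙ(E₀) = q·hⁿ + N·w` (`N ≠ 0`) and all lower `chₚ` (`0 < p < n`) on the `h`-line,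
with no semiregularity asked. For an ALGEBRAIC class `w` on a smooth projective variety this is the content of
Kleiman's normal form for vector bundles [cite: Fulton1998, Example 15.3.2] (there with Chern classes `cᵢ(E) = nᵢ hⁱ`,
`i < p`, and `(p-1)!·α = c_p(E) − n hᵖ`; Newton's identities convert to the Chern character); it is recorded here
only as a predicate — the deformation-theoretic question of the routes is `HasWeilClassDesignAt → HasBFSheafSeedAt`
at suitable anchors.

Contents: `HasWeilClassDesignAt`, `HasBFSheafSeedAt` and the pointwise door
`weilAnchorLocalClause_of_BF_of_hasBFSheafSeedAt`.
-/

noncomputable section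

open CategoryTheory AlgebraicGeometry
open _root_.Topology _root_.Filter _root_.Set

namespace Literature.AlgebraicGeometry.HodgeTheory

open Literature.AlgebraicTopology.SingularHomology Literature.AlgebraicGeometry.Motives

/-- **Class-level design at an anchor** (Kleiman normal-form shape, read through `C`): on every model `X₀ ≅ P.X`
there is a finite locally free `E₀` and rationals `q, N ≠ 0, c₁, …` with `chₙ(E₀) ↦ q·hⁿ + N·w` and
`chₚ(E₀) ↦ cₚ·hᵖ` for `0 < p < n` under the identification `X₀ ≅ P.X`. [cite: Fulton1998, Example 15.3.2] -/
def HasWeilClassDesignAt (C : ChernCharacterBetti) (n : ℕ) (P : Motives.AbelianVariety ℂ)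
    (h : complexBetti P.X 2) (w : complexBetti P.X (2 * n)) : Prop :=
  ∀ (X₀ : Motives.SchemeOver ℂ) (eX : P.X ≅ X₀), ∃ (E₀ : X₀.left.Modules)
    (_ : Motives.IsFiniteLocallyFree E₀) (q N : ℚ) (c : ℕ → ℚ), N ≠ 0 ∧
    complexBetti.map eX.hom (2 * n) (C.ch X₀ E₀ n) = ((q : ℚ) : ℂ) • cupPowTwo h n + ((N : ℚ) : ℂ) • w ∧
    ∀ p : ℕ, 0 < p → p < n →
      complexBetti.map eX.hom (2 * p) (C.ch X₀ E₀ p) = ((c p : ℚ) : ℂ) • cupPowTwo h p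

/-- **Buchweitz–Flenner sheaf seed at an anchor**: on every model `X₀ ≅ P.X` there is an index set `I ∋ n`, an
`I`-semiregular (`IsISemiregular · {q' | q' + 1 ∈ I}`) finite locally free `E₀` and rationals with
`chₙ(E₀) ↦ q·hⁿ + N·w` (`N ≠ 0`) and `chₚ(E₀) ↦ cₚ·hᵖ` for `p ∈ I ∖ {n}`.
[cite: BuchweitzFlenner2003, §5 Thm. 5.1] -/
def HasBFSheafSeedAt (C : ChernCharacterBetti) (n : ℕ) (P : Motives.AbelianVariety ℂ)
    (h : complexBetti P.X 2) (w : complexBetti P.X (2 * n)) : Prop :=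
  ∀ (X₀ : Motives.SchemeOver ℂ) (eX : P.X ≅ X₀), ∃ (I : Finset ℕ) (E₀ : X₀.left.Modules)
    (hE₀ : Motives.IsFiniteLocallyFree E₀) (q N : ℚ) (c : ℕ → ℚ), n ∈ I ∧ N ≠ 0 ∧
    IsISemiregular hE₀ {q' | q' + 1 ∈ I} ∧
    complexBetti.map eX.hom (2 * n) (C.ch X₀ E₀ n) = ((q : ℚ) : ℂ) • cupPowTwo h n + ((N : ℚ) : ℂ) • w ∧
    ∀ p' ∈ I, p' ≠ n → complexBetti.map eX.hom (2 * p') (C.ch X₀ E₀ p') =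
      ((c p' : ℚ) : ℂ) • cupPowTwo h p'

/-- **Door II′ at one anchor (Buchweitz–Flenner).** The named fact `BuchweitzFlenner2003_variationalHodge_ISemiregular`
and a BF sheaf seed at the anchor `(P, h, w)` give `WeilAnchorLocalClause n d P h w`: in a family of the clause
through `P ≅ 𝒳_{s₀}` with global `H`, `W` restricting to `h`, `w`, put `B := q·Hⁿ + N·W`; restrictions of global
classes are flat sections of `R f_* ℂ` and fibrewise of type `(p,p)` (`cupPowTwo` of a restricted hyperplane class,
resp. the hypothesis on `W`), so BF Thm 5.1 gives an open `W' ∋ s₀` on whose path component `B|_t` is algebraic;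
subtract `q·(H|_t)ⁿ` and divide by `N`. Mirror of `hasLocallyAlgebraicTensorAnchors_of_BF_of_tensorBFSheafSeeds`,
whose proof never uses the tensor structure. [cite: BuchweitzFlenner2003, §5 Thm. 5.1] -/
theorem weilAnchorLocalClause_of_BF_of_hasBFSheafSeedAt
    (hBF : BuchweitzFlenner2003_variationalHodge_ISemiregular) (C : ChernCharacterBetti) {n : ℕ}
    (hn : 0 < n) (d : ℕ) (P : Motives.AbelianVariety ℂ) (h : complexBetti P.X 2)
    (w : complexBetti P.X (2 * n)) (hseed : HasBFSheafSeedAt C n P h w) :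
    WeilAnchorLocalClause n d P h w := by
  intro 𝒳 S f hf h𝒳 hS hSirr hsm hfib H W hH hW s₀ e' hH₀ hW₀
  -- (1) `Rⁱf_*ℂ` is a local system on all of `S(ℂ)`, a path connected, locally path connected manifold
  haveI := hsm
  haveI := hSirr
  haveI : LocallyOfFiniteType S.hom := hS.locallyOfFiniteType
  haveI : ConnectedSpace (Motives.ComplexPoints S) :=
    (Motives.ComplexPoints.connectedSpace_iff_holds S).2 inferInstance
  obtain ⟨dS, hdS⟩ := exists_smoothOfRelativeDimension_of_connectedSpace_complexPoints S
  haveI := hdS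
  haveI := pathConnectedSpace_complexPoints_of_smoothOfRelativeDimension S dS
  have hU : IsCohomologicallyLocallyTrivialOn f (Set.univ : Set (Motives.ComplexPoints S)) :=
    isCohomologicallyLocallyTrivialOn_univ_of_isSmoothProjectiveFamily f dS hf hS
  letI := Motives.ComplexPoints.chartedSpace S dS
  haveI : LocallyPathConnectedSpace (Motives.ComplexPoints S) :=
    ChartedSpace.locallyPathConnectedSpace (EuclideanSpace ℝ (Fin (2 * dS))) (Motives.ComplexPoints S)
  let s₀' : (Set.univ : Set (Motives.ComplexPoints S)) := ⟨s₀, Set.mem_univ s₀⟩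
  -- (2) the sheaf seed on the model `e' : P ≅ 𝒳_{s₀}`
  obtain ⟨I, E₀, hE₀, q, N, c, hnI, hN0, hsr, hchk, hchp⟩ := hseed (Motives.fiberOver f s₀) e'
  have hN' : ((N : ℚ) : ℂ) ≠ 0 := by exact_mod_cast hN0
  -- the global class `B := q·Hⁿ + N·W` and its restrictions
  set Bcl : complexBetti 𝒳 (2 * n) := ((q : ℚ) : ℂ) • cupPowTwo H n + ((N : ℚ) : ℂ) • W with hBdef
  have hres : ∀ s : Motives.ComplexPoints S, complexBetti.map (Motives.fiberι f s) (2 * n) Bcl =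
      ((q : ℚ) : ℂ) • cupPowTwo (complexBetti.map (Motives.fiberι f s) 2 H) n +
        ((N : ℚ) : ℂ) • complexBetti.map (Motives.fiberι f s) (2 * n) W := by
    intro s
    rw [hBdef, map_add, map_smul, map_smul, complexBetti_map_cupPowTwo']
  have hBrat : ∀ s : Motives.ComplexPoints S,
      IsOfHodgeType (2 * n) (Motives.fiberOver f s) (2 * n) n n
        (complexBetti.map (Motives.fiberι f s) (2 * n) Bcl) := by
    intro s
    rw [hres]
    exact ((isOfHodgeType_cupPowTwo (hf.isSmoothProjective s) (hH s).2 n).smul _).add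
      (hf.isSmoothProjective s) ((hW s).2.smul _)
  -- `ch_n(ℰ₀) = B|_{s₀}` and `ch_p(ℰ₀) = c_p·Hᵖ|_{s₀}` (pull back by the chart `e'` and compare on `P`)
  have hchk' : C.ch (Motives.fiberOver f s₀) E₀ n = complexBetti.map (Motives.fiberι f s₀) (2 * n) Bcl := by
    apply complexBetti.map_injective_of_iso e' (2 * n)
    rw [hchk, hres, map_add, map_smul, map_smul, complexBetti_map_cupPowTwo', hH₀, hW₀]
  have hHp₀ : ∀ p' : ℕ, complexBetti.map e'.hom (2 * p')
      (complexBetti.map (Motives.fiberι f s₀) (2 * p') (cupPowTwo H p')) = cupPowTwo h p' := by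
    intro p'
    rw [complexBetti_map_cupPowTwo', complexBetti_map_cupPowTwo', hH₀]
  have hchp' : ∀ p' ∈ I, p' ≠ n → C.ch (Motives.fiberOver f s₀) E₀ p' =
      complexBetti.map (Motives.fiberι f s₀) (2 * p') (((c p' : ℚ) : ℂ) • cupPowTwo H p') := by
    intro p' hp' hp'n
    apply complexBetti.map_injective_of_iso e' (2 * p')
    rw [hchp p' hp' hp'n, map_smul, map_smul, hHp₀ p']
  -- (3) Buchweitz–Flenner's hypotheses over `U = S(ℂ)`: the transports of `ch_p(ℰ₀)`, `p ∈ I`, are of type `(p,p)`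
  have hHodge : ∀ p' ∈ I, ∀ (t : (Set.univ : Set (Motives.ComplexPoints S)))
      (γ : Path.Homotopic.Quotient s₀' t),
      IsOfHodgeType (2 * n) (Motives.fiberOver f t.1) (2 * p') p' p'
        (transportFun f (2 * p') hU γ (C.ch (Motives.fiberOver f s₀'.1) E₀ p')) := by
    intro p' hp' t γ
    by_cases hp'n : p' = n
    · subst hp'n
      change IsOfHodgeType (2 * p') (Motives.fiberOver f t.1) (2 * p') p' p'
        (transportFun f (2 * p') hU γ (C.ch (Motives.fiberOver f s₀) E₀ p'))
      rw [hchk', transportFun_map_fiberι f (2 * p') hU γ Bcl]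
      exact hBrat t.1
    · change IsOfHodgeType (2 * n) (Motives.fiberOver f t.1) (2 * p') p' p'
        (transportFun f (2 * p') hU γ (C.ch (Motives.fiberOver f s₀) E₀ p'))
      rw [hchp' p' hp' hp'n, transportFun_map_fiberι f (2 * p') hU γ, map_smul, complexBetti_map_cupPowTwo']
      exact (isOfHodgeType_cupPowTwo (hf.isSmoothProjective t.1) (hH t.1).2 p').smul _
  obtain ⟨W', hWo, hW'₀, hWU, hW'⟩ := hBF C f (2 * n) hf hsm hU s₀' E₀ hE₀ I hsr hHodge
  -- (4) conclude on the path component of `s₀` in `W'`, dividing by `N`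
  refine ⟨pathComponentIn W' s₀, q / N, hWo.pathComponentIn s₀, mem_pathComponentIn_self hW'₀,
    fun t ht ↦ ?_⟩
  have hj : JoinedIn W' s₀ t := ht
  have hpm : ∀ u, hj.somePath u ∈ W' := hj.somePath_mem
  let γ : Path (⟨s₀, hW'₀⟩ : W') ⟨t, pathComponentIn_subset ht⟩ :=
    { toFun := fun u ↦ ⟨hj.somePath u, hpm u⟩
      continuous_toFun := hj.somePath.continuous.subtype_mk _
      source' := Subtype.ext hj.somePath.source
      target' := Subtype.ext hj.somePath.target }
  have hmem := hW' n hnI ⟨t, pathComponentIn_subset ht⟩ ⟦γ⟧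
  have htr : transportFun f (2 * n) (hU.mono hWU hWo) ⟦γ⟧ (C.ch (Motives.fiberOver f s₀) E₀ n) =
      complexBetti.map (Motives.fiberι f t) (2 * n) Bcl := by
    rw [hchk']
    exact transportFun_map_fiberι f (2 * n) (hU.mono hWU hWo) ⟦γ⟧ Bcl
  change transportFun f (2 * n) (hU.mono hWU hWo) ⟦γ⟧ (C.ch (Motives.fiberOver f s₀) E₀ n) ∈ _ at hmem
  rw [htr, hres] at hmem
  have hmem' := Submodule.smul_mem (algebraicClasses (Motives.fiberOver f t) n) (((N : ℚ) : ℂ)⁻¹) hmem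
  have heq : (((N : ℚ) : ℂ)⁻¹) • (((q : ℚ) : ℂ) • cupPowTwo (complexBetti.map (Motives.fiberι f t) 2 H) n +
        ((N : ℚ) : ℂ) • complexBetti.map (Motives.fiberι f t) (2 * n) W) =
      (((q / N : ℚ)) : ℂ) • cupPowTwo (complexBetti.map (Motives.fiberι f t) 2 H) n +
        complexBetti.map (Motives.fiberι f t) (2 * n) W := by
    rw [smul_add, smul_smul, smul_smul, inv_mul_cancel₀ hN', one_smul, Rat.cast_div, div_eq_inv_mul]
  rw [heq] at hmem'
  exact hmem'

end Literature.AlgebraicGeometry.HodgeTheory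

end
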